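import Literature.Analysis.SpecialFunctions.ThetaRiemannSum
import Literature.Analysis.SpecialFunctions.JacobiThetaSupBound
import HarnessLib

/-!
# Shifted Gaussian lattice sums: `Σ_{n∈ℤ} e^{-c(n+β)²} = √(π/c) · (1 + O(e^{-π²/c}))`, tails and windows

The one-dimensional local-limit step of the Laplace method on a lattice, uniform in the shift:

* `abs_tsum_exp_neg_mul_sq_sub_sqrt_le` — Poisson summation (Mathlib's
  `Complex.tsum_exp_neg_quadratic`) gives `|Σ_{n∈ℤ} e^{-c(n+β)²} - √(π/c)| ≤ √(π/c)(G(π²/c) - 1)`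
  with `G = gaussLatticeSum` (file `ThetaRiemannSum`), hence (`…_le'`) `≤ √(π/c) · 2/(e^{π²/c} - 1)`;
* `tsum_gauss_tail_indicator_le` — `Σ_{|k-ν| ≥ W} e^{-s(k-ν)²} ≤ e^{-sW²/2} · 2/(1 - e^{-s/2})`;
* `sum_window_gauss_bounds` — two-sided bounds for `Σ_{k∈I} e^{-s(k-ν)²}` over any finite window
  `I ⊇ {k : |k-ν| < W}`.

All statements are folklore; theorems only (no definition, no named fact).
-/

noncomputable section

open Real Filter Topology Complex

namespace Literature.Analysis.SpecialFunctions

/-- The summand identity behind Poisson summation for a shifted Gaussian: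
`exp(-π a n² + 2π b n) = e^{-c(n+β)²} e^{cβ²}` for `a = c/π`, `b = -cβ/π`. [folklore] -/
theorem cexp_shifted_gauss_term (c β : ℝ) (n : ℤ) :
    cexp (-π * ((c / π : ℝ) : ℂ) * (n : ℂ) ^ 2 + 2 * π * ((-(c * β) / π : ℝ) : ℂ) * n) =
      ((rexp (-(c * ((n : ℝ) + β) ^ 2)) * rexp (c * β ^ 2) : ℝ) : ℂ) := by
  rw [← Real.exp_add, Complex.ofReal_exp]
  congr 1
  have hπ : (π : ℂ) ≠ 0 := Complex.ofReal_ne_zero.mpr Real.pi_pos.ne'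
  push_cast
  field_simp
  ring

/-- The dual summand: `exp(-π/a (n + I b)²) = e^{-π²n²/c} e^{cβ²} e^{2πiβn}`. [folklore] -/
theorem cexp_dual_gauss_term {c : ℝ} (hc : 0 < c) (β : ℝ) (n : ℤ) :
    cexp (-π / ((c / π : ℝ) : ℂ) * ((n : ℂ) + I * ((-(c * β) / π : ℝ) : ℂ)) ^ 2) =
      ((rexp (-(π ^ 2 / c * (n : ℝ) ^ 2)) * rexp (c * β ^ 2) : ℝ) : ℂ) *
        cexp ((2 * π * β * n : ℝ) * I) := by
  rw [← Real.exp_add, Complex.ofReal_exp, ← Complex.exp_add]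
  congr 1
  have hπ : (π : ℂ) ≠ 0 := Complex.ofReal_ne_zero.mpr Real.pi_pos.ne'
  have hc' : (c : ℂ) ≠ 0 := Complex.ofReal_ne_zero.mpr hc.ne'
  push_cast
  field_simp
  ring_nf
  rw [Complex.I_sq]
  ring

/-- `1 / (c/π)^{1/2} = √(π/c)` as complex numbers. [folklore] -/
theorem one_div_cpow_half_eq {c : ℝ} (hc : 0 < c) :
    1 / (((c / π : ℝ) : ℂ)) ^ (1 / 2 : ℂ) = ((Real.sqrt (π / c) : ℝ) : ℂ) := by
  have hcπ : 0 ≤ c / π := (div_pos hc Real.pi_pos).le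
  have : (((c / π : ℝ) : ℂ)) ^ (1 / 2 : ℂ) = (((c / π) ^ (1 / 2 : ℝ) : ℝ) : ℂ) := by
    rw [Complex.ofReal_cpow hcπ]
    norm_num
  rw [this, ← Real.sqrt_eq_rpow, ← Complex.ofReal_one, ← Complex.ofReal_div]
  congr 1
  rw [one_div, ← Real.sqrt_inv, inv_div]

/-- **Poisson summation for the shifted Gaussian, with the theta tail as error**:
`|Σ_{n∈ℤ} e^{-c(n+β)²} - √(π/c)| ≤ √(π/c) · (G(π²/c) - 1)` where `G(s) = Σ_{n∈ℤ} e^{-s n²}`,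
uniformly in the shift `β`. [folklore] (Jacobi's imaginary transformation, Mathlib's
`Complex.tsum_exp_neg_quadratic`.) -/
theorem abs_tsum_exp_neg_mul_sq_sub_sqrt_le {c : ℝ} (hc : 0 < c) (β : ℝ) :
    |∑' n : ℤ, rexp (-(c * ((n : ℝ) + β) ^ 2)) - Real.sqrt (π / c)| ≤
      Real.sqrt (π / c) * (gaussLatticeSum (π ^ 2 / c) - 1) := by
  -- notation
  set S : ℝ := ∑' n : ℤ, rexp (-(c * ((n : ℝ) + β) ^ 2)) with hS
  set E : ℝ := rexp (c * β ^ 2) with hE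
  have hE0 : 0 < E := Real.exp_pos _
  set r : ℤ → ℝ := fun n => rexp (-(π ^ 2 / c * (n : ℝ) ^ 2)) with hr
  set u : ℤ → ℂ := fun n => cexp ((2 * π * β * n : ℝ) * I) with hu
  have hu1 : ∀ n, ‖u n‖ = 1 := fun n => by
    rw [hu]; exact Complex.norm_exp_ofReal_mul_I _
  have hu0 : u 0 = 1 := by simp [hu]
  have hπc : 0 < π ^ 2 / c := by positivity
  have hsr : Summable r := by
    refine ((tsum_exp_neg_mul_sq_le hπc 0).1).congr (fun n => ?_)
    simp [hr]
  have hrpos : ∀ n, 0 < r n := fun n => Real.exp_pos _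
  have hG : ∑' n : ℤ, r n = gaussLatticeSum (π ^ 2 / c) := by rw [gaussLatticeSum]
  -- the complex identity
  have ha : 0 < (((c / π : ℝ) : ℂ)).re := by
    rw [Complex.ofReal_re]; exact div_pos hc Real.pi_pos
  have key := Complex.tsum_exp_neg_quadratic ha (((-(c * β) / π : ℝ) : ℂ))
  simp only [cexp_shifted_gauss_term c β, cexp_dual_gauss_term hc β, one_div_cpow_half_eq hc]
    at key
  -- left side: `S * E`
  have hsumS : Summable fun n : ℤ => rexp (-(c * ((n : ℝ) + β) ^ 2)) :=
    (tsum_exp_neg_mul_sq_le hc β).1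
  have lhs : (∑' n : ℤ, (((rexp (-(c * ((n : ℝ) + β) ^ 2)) * rexp (c * β ^ 2) : ℝ) : ℂ))) =
      ((S * E : ℝ) : ℂ) := by
    rw [← Complex.ofReal_tsum, tsum_mul_right]
  -- right side: `√(π/c) * E * Σ r n * u n`
  have hsw : Summable fun n : ℤ => ((r n : ℝ) : ℂ) * u n := by
    refine Summable.of_norm ?_
    refine hsr.congr (fun n => ?_)
    rw [norm_mul, hu1, Complex.norm_real, Real.norm_eq_abs, abs_of_pos (hrpos n), mul_one]
  have rhs : (∑' n : ℤ, (((rexp (-(π ^ 2 / c * (n : ℝ) ^ 2)) * rexp (c * β ^ 2) : ℝ) : ℂ)) *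
      cexp ((2 * π * β * n : ℝ) * I)) = ((E : ℝ) : ℂ) * ∑' n : ℤ, ((r n : ℝ) : ℂ) * u n := by
    rw [← tsum_mul_left]
    refine tsum_congr (fun n => ?_)
    simp only [hr, hu, hE]; push_cast; ring
  rw [lhs, rhs] at key
  -- cancel `E`
  have hT : ((S : ℝ) : ℂ) = ((Real.sqrt (π / c) : ℝ) : ℂ) * ∑' n : ℤ, ((r n : ℝ) : ℂ) * u n := by
    have hE' : ((E : ℝ) : ℂ) ≠ 0 := Complex.ofReal_ne_zero.mpr hE0.ne'
    have : ((S : ℝ) : ℂ) * (E : ℂ) = (((Real.sqrt (π / c) : ℝ) : ℂ) * ∑' n : ℤ, ((r n : ℝ) : ℂ) * u n) * (E : ℂ) := by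
      rw [← Complex.ofReal_mul, key]; ring
    exact mul_right_cancel₀ hE' this
  -- `Σ r n u n - 1 = Σ_{n ≠ 0} r n u n`, of norm at most `G - 1`
  set w : ℤ → ℂ := fun n => ((r n : ℝ) : ℂ) * u n with hw
  have hw0 : w 0 = 1 := by simp [hw, hu0, hr]
  have hsplit : ∑' n : ℤ, w n = w 0 + ∑' n : ℤ, ite (n = 0) 0 (w n) := hsw.tsum_eq_add_tsum_ite 0
  have hsplitr : ∑' n : ℤ, r n = r 0 + ∑' n : ℤ, ite (n = 0) 0 (r n) := hsr.tsum_eq_add_tsum_ite 0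
  have hr0 : r 0 = 1 := by simp [hr]
  have hnorm : ‖∑' n : ℤ, ite (n = 0) (0 : ℂ) (w n)‖ ≤ ∑' n : ℤ, ite (n = 0) (0 : ℝ) (r n) := by
    have hs1 : Summable fun n : ℤ => ite (n = 0) (0 : ℝ) (r n) := by
      refine Summable.of_nonneg_of_le (fun n => ?_) (fun n => ?_) hsr
      · split_ifs <;> [exact le_rfl; exact (Real.exp_pos _).le]
      · split_ifs <;> [exact (Real.exp_pos _).le; exact le_rfl]
    refine le_trans (norm_tsum_le_tsum_norm ?_) (le_of_eq (tsum_congr (fun n => ?_)))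
    · refine Summable.of_nonneg_of_le (fun n => norm_nonneg _) (fun n => ?_) hs1
      split_ifs
      · simp
      · rw [hw]; dsimp only
        rw [norm_mul, hu1, Complex.norm_real, Real.norm_eq_abs, abs_of_pos (hrpos n), mul_one]
    · split_ifs
      · simp
      · rw [hw]; dsimp only
        rw [norm_mul, hu1, Complex.norm_real, Real.norm_eq_abs, abs_of_pos (hrpos n), mul_one]
  -- conclude
  have hdiff : ((S - Real.sqrt (π / c) : ℝ) : ℂ) =
      ((Real.sqrt (π / c) : ℝ) : ℂ) * ∑' n : ℤ, ite (n = 0) (0 : ℂ) (w n) := by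
    push_cast
    rw [hT, hsplit, hw0]; ring
  have hfin : |S - Real.sqrt (π / c)| = Real.sqrt (π / c) * ‖∑' n : ℤ, ite (n = 0) (0 : ℂ) (w n)‖ := by
    have e1 : |S - Real.sqrt (π / c)| = ‖((S - Real.sqrt (π / c) : ℝ) : ℂ)‖ := by
      rw [Complex.norm_real, Real.norm_eq_abs]
    rw [e1, hdiff, norm_mul, Complex.norm_real, Real.norm_eq_abs,
      abs_of_nonneg (Real.sqrt_nonneg _)]
  rw [hfin, ← hG, hsplitr, hr0, add_sub_cancel_left]
  exact mul_le_mul_of_nonneg_left hnorm (Real.sqrt_nonneg _)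

/-- **Shifted Gaussian lattice sums are `√(π/c)` up to a theta tail**:
`|Σ_{n∈ℤ} e^{-c(n+β)²} - √(π/c)| ≤ √(π/c) · 2/(e^{π²/c} - 1)`, uniformly in `β`. [folklore] -/
theorem abs_tsum_exp_neg_mul_sq_sub_sqrt_le' {c : ℝ} (hc : 0 < c) (β : ℝ) :
    |∑' n : ℤ, rexp (-(c * ((n : ℝ) + β) ^ 2)) - Real.sqrt (π / c)| ≤
      Real.sqrt (π / c) * (2 / (rexp (π ^ 2 / c) - 1)) := by
  refine le_trans (abs_tsum_exp_neg_mul_sq_sub_sqrt_le hc β) ?_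
  refine mul_le_mul_of_nonneg_left ?_ (Real.sqrt_nonneg _)
  have := gaussLatticeSum_le (c := π ^ 2 / c) (by positivity)
  linarith

/-! ### Tails and windows -/

/-- **Gaussian tail over the lattice**: `Σ_{k : |k-ν| ≥ W} e^{-s(k-ν)²} ≤ e^{-sW²/2} · 2/(1 - e^{-s/2})`,
uniformly in `ν`. [folklore] -/
theorem tsum_gauss_tail_indicator_le {s : ℝ} (hs : 0 < s) (ν : ℝ) {W : ℝ} (hW : 0 ≤ W) :
    Summable (fun k : ℤ => if W ≤ |(k : ℝ) - ν| then rexp (-(s * ((k : ℝ) - ν) ^ 2)) else 0) ∧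
      ∑' k : ℤ, (if W ≤ |(k : ℝ) - ν| then rexp (-(s * ((k : ℝ) - ν) ^ 2)) else 0) ≤
        rexp (-(s * W ^ 2 / 2)) * (2 / (1 - rexp (-(s / 2)))) := by
  have hs2 : 0 < s / 2 := by positivity
  obtain ⟨hsum2, hle2⟩ := tsum_exp_neg_mul_sq_le hs2 (-ν)
  set g : ℤ → ℝ := fun k => rexp (-(s * W ^ 2 / 2)) * rexp (-(s / 2 * ((k : ℝ) + -ν) ^ 2)) with hg
  have hgs : Summable g := hsum2.mul_left _
  have hle : ∀ k : ℤ, (if W ≤ |(k : ℝ) - ν| then rexp (-(s * ((k : ℝ) - ν) ^ 2)) else 0) ≤ g k := by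
    intro k
    split_ifs with hk
    · rw [hg]; dsimp only
      rw [← Real.exp_add]
      apply Real.exp_le_exp.mpr
      have hW2 : W ^ 2 ≤ ((k : ℝ) - ν) ^ 2 := by
        calc W ^ 2 ≤ |(k : ℝ) - ν| ^ 2 := pow_le_pow_left₀ hW hk 2
          _ = ((k : ℝ) - ν) ^ 2 := sq_abs _
      nlinarith
    · exact mul_nonneg (Real.exp_pos _).le (Real.exp_pos _).le
  have h0 : ∀ k : ℤ, 0 ≤ (if W ≤ |(k : ℝ) - ν| then rexp (-(s * ((k : ℝ) - ν) ^ 2)) else 0) := by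
    intro k; split_ifs <;> [exact (Real.exp_pos _).le; exact le_rfl]
  have hsum : Summable (fun k : ℤ => if W ≤ |(k : ℝ) - ν| then rexp (-(s * ((k : ℝ) - ν) ^ 2)) else 0) :=
    Summable.of_nonneg_of_le h0 hle hgs
  refine ⟨hsum, le_trans (hsum.tsum_le_tsum hle hgs) ?_⟩
  rw [hg, tsum_mul_left]
  exact mul_le_mul_of_nonneg_left hle2 (Real.exp_pos _).le

/-- **Gaussian window sums** (the one-dimensional local limit step): if the finite window `I ⊆ ℤ`
contains every lattice point within `W` of the centre `ν`, then
`√(π/s)(1 - 2/(e^{π²/s}-1)) - e^{-sW²/2}·2/(1-e^{-s/2}) ≤ Σ_{k∈I} e^{-s(k-ν)²} ≤ √(π/s)(1 + 2/(e^{π²/s}-1))`.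
[folklore] -/
theorem sum_window_gauss_bounds {s : ℝ} (hs : 0 < s) (ν : ℝ) {W : ℝ} (hW : 0 ≤ W) (I : Finset ℤ)
    (hI : ∀ k : ℤ, |(k : ℝ) - ν| < W → k ∈ I) :
    Real.sqrt (π / s) * (1 - 2 / (rexp (π ^ 2 / s) - 1)) -
        rexp (-(s * W ^ 2 / 2)) * (2 / (1 - rexp (-(s / 2)))) ≤
        ∑ k ∈ I, rexp (-(s * ((k : ℝ) - ν) ^ 2)) ∧
      ∑ k ∈ I, rexp (-(s * ((k : ℝ) - ν) ^ 2)) ≤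
        Real.sqrt (π / s) * (1 + 2 / (rexp (π ^ 2 / s) - 1)) := by
  set f : ℤ → ℝ := fun k => rexp (-(s * ((k : ℝ) - ν) ^ 2)) with hf
  have hf' : f = fun k : ℤ => rexp (-(s * ((k : ℝ) + -ν) ^ 2)) := by
    funext k; simp [hf, sub_eq_add_neg]
  obtain ⟨hsum, -⟩ := tsum_exp_neg_mul_sq_le hs (-ν)
  rw [← hf'] at hsum
  have hP := abs_tsum_exp_neg_mul_sq_sub_sqrt_le' hs (-ν)
  rw [← hf'] at hP
  rw [abs_le] at hP
  have hf0 : ∀ k, 0 ≤ f k := fun k => (Real.exp_pos _).le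
  refine ⟨?_, ?_⟩
  · -- lower bound: `Σ_I f = Σ f - Σ_{Iᶜ} f ≥ Σ f - tail`
    obtain ⟨htsum, htle⟩ := tsum_gauss_tail_indicator_le hs ν hW
    have hsplit := hsum.sum_add_tsum_compl (s := I)
    have hcompl : ∑' k : ↥((I : Set ℤ)ᶜ), f k ≤
        ∑' k : ℤ, (if W ≤ |(k : ℝ) - ν| then rexp (-(s * ((k : ℝ) - ν) ^ 2)) else 0) := by
      rw [tsum_subtype ((I : Set ℤ)ᶜ) f]
      refine Summable.tsum_le_tsum (fun k => ?_) (hsum.indicator _) htsum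
      by_cases hk : k ∈ ((I : Set ℤ)ᶜ)
      · rw [Set.indicator_of_mem hk]
        have hkW : W ≤ |(k : ℝ) - ν| := by
          by_contra h
          push Not at h
          exact hk (hI k h)
        rw [if_pos hkW]
      · rw [Set.indicator_of_notMem hk]
        split_ifs <;> [exact (Real.exp_pos _).le; exact le_rfl]
    have : ∑ k ∈ I, f k = ∑' k : ℤ, f k - ∑' k : ↥((I : Set ℤ)ᶜ), f k := by linarith
    rw [this]
    linarith [hP.1]
  · calc ∑ k ∈ I, f k ≤ ∑' k : ℤ, f k := hsum.sum_le_tsum I (fun k _ => hf0 k)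
      _ ≤ _ := by linarith [hP.2]

end Literature.Analysis.SpecialFunctions
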